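import Mathlib
import Summits.Ventures.PercRepro2.TypedCoupled

/-!
# The typed bases are the multivariate Bernstein coefficients of (HCOV)'s cubic form (blind cell
PercRepro2, night-3 g18, 2026-08-28; `proofs/NIGHT3-CERT.md` §27.3)

`Gc_eq_sum_typedCount`: for every weight vector `p`,

  `Gc p = Σ_{τ : E → Fin 4} (∏ e, p e ^ τ e · (1 − p e) ^ (3 − τ e)) · typedCount univ z τ K₃`

— `hcov_cubic` (`Gc = triSum p ∅`), `coupledSum_iid` (the i.i.d. law is a product of exchangeable
edge laws) and `coupledSum_eq_sum_typedCount` (the level expansion). So row 2′TRI, `TypedBases`,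
is literally the nonnegativity of every coefficient of `Gc` in the tensor Bernstein basis of degree
`3` per edge, and `Gc_nonneg_of_typedBases'` recovers (HCOV) from it coefficient by coefficient.
Own work; standard axioms.
-/

namespace Summit.Ventures.PercRepro2

namespace CovForm

section Bernstein

variable {V : Type*} {E : Type*} [Fintype E] [DecidableEq E] {R : Type*} [Field R]
  [LinearOrder R] [IsStrictOrderedRing R]

/-- **The tensor Bernstein expansion of `Gc`**: its coefficients are the typed counts over all
edges. -/
theorem Gc_eq_sum_typedCount (p : E → R) (ends : E → Sym2 V) (o a₁ a₂ a₃ b : V) (z : Config E) :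
    Gc p ends o a₁ a₂ a₃ b =
      ∑ τ : E → Fin 4, (∏ e, p e ^ ((τ e : Fin 4) : ℕ) * (1 - p e) ^ (3 - ((τ e : Fin 4) : ℕ))) *
        typedCount Finset.univ z (fun e => ((τ e : Fin 4) : ℕ))
          (K3 ends o a₁ a₂ a₃ b : Config E → Config E → Config E → R) := by
  rw [hcov_cubic p ends o a₁ a₂ a₃ b (fun _ => 0), ← coupledSum_iid p (fun _ => 0),
    coupledSum_eq_sum_typedCount _ z]

/-- **(HCOV) from the typed bases, coefficient by coefficient**: every Bernstein weight is
nonnegative on `[0, 1]^E`. -/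
theorem Gc_nonneg_of_typedBases' (ends : E → Sym2 V) (o a₁ a₂ a₃ b : V)
    (h : TypedBases (R := R) ends o a₁ a₂ a₃ b) (p : E → R) (hp : ∀ e, 0 ≤ p e ∧ p e ≤ 1) :
    0 ≤ Gc p ends o a₁ a₂ a₃ b := by
  rw [Gc_eq_sum_typedCount p ends o a₁ a₂ a₃ b (fun _ => false)]
  refine Finset.sum_nonneg fun τ _ => mul_nonneg (Finset.prod_nonneg fun e _ =>
    mul_nonneg (pow_nonneg (hp e).1 _) (pow_nonneg (sub_nonneg.mpr (hp e).2) _)) ?_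
  have hle : ∀ e, ((τ e : Fin 4) : ℕ) ≤ 3 := fun e => Nat.lt_succ_iff.1 (τ e).isLt
  rw [typedCount_univ_eq_filter (fun _ => false) _ hle]
  exact h _ _ _ fun e he => (Finset.mem_filter.1 he).2

end Bernstein

end CovForm

end Summit.Ventures.PercRepro2
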